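import Summits.ABC.IUTFork.Repair.Mu6CarrierAtTwo
import HarnessLib

/-!
# R4MU6-INST (census row O-19), KEY (3) OPTIONAL KERNEL NUMERALS — scratch (NOT filed unless the referee asks)

PROOF-ONLY (0 defs, 0 `Prop` facts). (i) The closed form of [IUTchIV] Prop. 1.2's `b` at `p = 2` used by the desk sign table
ROUND4/R4-OBJ-MU6-INST-L5-t2.tsv: `logRadiusB 2 e = (k + 1) − 1/e` for `2^k ≤ e < 2^(k+1)`, i.e. `b_e = 1 + ⌊log₂ e⌋ − 1/e`;
(ii) the hypothesis `hlt` of `Mu6CarrierAtTwo.twoAdic_not_mem_topLabel_of_large_l` as CLOSED NUMERALS at the worked rows of the memo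
(big Frey triple 2⁵·67⁸·107·22381 + 5⁴·53⁶·353⁵ = 3²²·7¹⁴·43·83, H = −v₂(j) = 2): at l = 107 it HOLDS for both ends of the e_w bracket
{3210, 6420}; at l = 13 (bracket {390, 780}) it FAILS already at e = 390 (the face does not fire; the top label is undecided there).
No `Mu6InitialThetaData` inhabitant exists in the tree, so nothing here instantiates the μ₆ face BY NAME; these are the arithmetic
comparisons a future inhabitant would discharge `hlt` with by `exact`. computed-in-kernel ≠ a statement about print; no side taken on
[IUTchI–IV] / [ExpEst] or any author; nothing here asserts abc proved or refuted. [claim: Mochizuki2012, status: disputed]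
-/

noncomputable section

namespace Summit.ABC.IUTFork.Repair.Mu6TwoAdicInstances

open Literature.IUT.LogVolume

/-- **`b_e` at `p = 2` in closed form**: `2^k ≤ e < 2^(k+1) ⟹ logRadiusB 2 e = (k+1) − 1/e` (`⌊log(2e)/log 2⌋ = k + 1`).
[claim: Mochizuki2012, status: disputed] -/
theorem logRadiusB_two_eq (e k : ℕ) (h1 : 2 ^ k ≤ e) (h2 : e < 2 ^ (k + 1)) :
    logRadiusB 2 e = ((k : ℝ) + 1) - 1 / e := by
  have h2k : (0 : ℝ) < (2 : ℝ) ^ k := by positivity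
  have h1' : ((2 : ℝ) ^ k) ≤ (e : ℝ) := by exact_mod_cast h1
  have h2' : (e : ℝ) < (2 : ℝ) ^ (k + 1) := by exact_mod_cast h2
  have he : (0 : ℝ) < e := lt_of_lt_of_le h2k h1'
  have hlog2 : 0 < Real.log 2 := Real.log_pos one_lt_two
  have hsimp : (2 : ℝ) * (e : ℝ) / ((2 : ℝ) - 1) = 2 * e := by norm_num
  have hpow1 : Real.log ((2 : ℝ) ^ (k + 1)) = ((k : ℝ) + 1) * Real.log 2 := by
    rw [Real.log_pow]; push_cast; ring
  have hpow2 : Real.log ((2 : ℝ) ^ (k + 2)) = ((k : ℝ) + 1 + 1) * Real.log 2 := by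
    rw [Real.log_pow]; push_cast; ring
  have hfloor : ⌊Real.log ((2 : ℝ) * (e : ℝ) / ((2 : ℝ) - 1)) / Real.log 2⌋ = (k : ℤ) + 1 := by
    rw [Int.floor_eq_iff, hsimp]
    push_cast
    constructor
    · rw [le_div_iff₀ hlog2, ← hpow1]
      apply Real.log_le_log (by positivity)
      rw [pow_succ]
      linarith
    · rw [div_lt_iff₀ hlog2, ← hpow2]
      apply Real.log_lt_log (by positivity)
      have : (2 : ℝ) ^ (k + 2) = 2 * 2 ^ (k + 1) := by ring
      rw [this]
      linarith
  unfold logRadiusB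
  push_cast
  rw [hfloor]
  push_cast
  ring

/-- KEY (3)(a): `hlt` of `twoAdic_not_mem_topLabel_of_large_l` at the big Frey triple, `l = 107`, `H = 2`, BOTH ends of the bracket
`e_w ∈ {3210, 6420}`: `8·107·(b_e + 2) < 104·108·2` (11983.73… / 12839.86… < 22464). [claim: Mochizuki2012, status: disputed] -/
theorem hlt_bigFrey_l107 {e : ℕ} (he : e = 3210 ∨ e = 6420) :
    8 * ((107 : ℕ) : ℝ) * (logRadiusB 2 e + 2) < (((107 : ℕ) : ℝ) - 3) * (((107 : ℕ) : ℝ) + 1) * (2 : ℝ) := by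
  rcases he with rfl | rfl
  · rw [logRadiusB_two_eq 3210 11 (by norm_num) (by norm_num)]; norm_num
  · rw [logRadiusB_two_eq 6420 12 (by norm_num) (by norm_num)]; norm_num

/-- … and at `l = 13`, `H = 2` the same hypothesis FAILS already at the small end `e_w = 390` of the bracket (`8·13·(b₃₉₀ + 2) =
1143.73… ≥ 280`): the NEG face does not fire there (top label undecided on the desk). [claim: Mochizuki2012, status: disputed] -/
theorem not_hlt_bigFrey_l13 :
    ¬ 8 * ((13 : ℕ) : ℝ) * (logRadiusB 2 390 + 2) < (((13 : ℕ) : ℝ) - 3) * (((13 : ℕ) : ℝ) + 1) * (2 : ℝ) := by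
  rw [logRadiusB_two_eq 390 8 (by norm_num) (by norm_num)]; norm_num

/-- The minimal-margin decided row of the table: (2⁷·23⁸ + 19⁹·857² = 3²²·13·47²·263, l = 17), `H = 6`, hardest end `e_w = 340`:
`8·17·(b₃₄₀ + 2) = 1495.6 < 14·18·6 = 1512`. [claim: Mochizuki2012, status: disputed] -/
theorem hlt_row23pow8_l17 :
    8 * ((17 : ℕ) : ℝ) * (logRadiusB 2 340 + 2) < (((17 : ℕ) : ℝ) - 3) * (((17 : ℕ) : ℝ) + 1) * (6 : ℝ) := by
  rw [logRadiusB_two_eq 340 8 (by norm_num) (by norm_num)]; norm_num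

end Summit.ABC.IUTFork.Repair.Mu6TwoAdicInstances

end
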